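import Literature.Probability.Percolation.TriBoundaryZones
import Literature.Probability.Percolation.TriBoundaryOrientation
import HarnessLib

/-!
# The labels of the boundary traversal advance anticlockwise

Topic `Literature/Probability/Percolation`; family `crit-perc`. The zone form of `tips_advance`
(`TriBoundaryOrientation.lean`) for the inner approximation of a conformal rectangle
`R = (D; P₀, P₁, P₂, P₃)` whose boundary loop is anticlockwise (`D.index = 1`): along the
anticlockwise traversal of `∂G_δ⁻` (Bollobás–Riordan, *Percolation* (2006), Ch. 7 p. 191: "we are
first close to `Γ₁⁻`, then to `Γ₂⁻`, and so on"), **the label following the label `i` is `i + 1`**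
(`IsLabel.next_eq_add_one`): if positions `n₁ < n₂ < c < n₁ + #∂G` are such that `n₁` and `c`
carry the labels `i` and `j ≠ i`, no label other than `i` occurs strictly between `n₁` and `c`, the
tails of `n₂` are far from those of `n₁` and `c`, and a face of `G` lies near an interior point of the opposite arc
`A_{i+2}`, then `j = i + 1`. Proof: the zones between the last label `i` and `c` are one corner
zone, adjacent to both labels, so `j = i ± 1`; if `j = i - 1` then `tips_advance` (with the far
point on `A_{i+2}`) makes the boundary parameter of the tip at `c` larger than that at `n₁`,
whereas `A_{i-1}` precedes `Aᵢ`.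

Also: the parameter bookkeeping of the four arcs of a conformal rectangle (`cr_marks`,
`cr_nextMark`, `exists_param_of_mem_arc_add_three`, `boundary_mem_arc_add_three`,
`len_add_three_add_len_lt_one`).

## References

* B. Bollobás, O. Riordan, *Percolation*, Cambridge University Press (2006), Ch. 7 §7.2.5 p. 191.

## Mathlib / tree

Tree: `TriBoundaryZones.lean` (`IsLabel`, `IsCornerZone`, `exists_zone`, adjacency lemmas),
`TriBoundaryOrientation.lean` (`tips_advance`), `TriInnerApproxWinding.lean` (`innerTether`,
`innerCompFinset_conn`, `innerApprox_deep`), `PlanarDomainsTopology.lean` (`nextMark_of_lt`,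
`nextMark_of_not_lt`).
-/

noncomputable section

open Set Metric Literature.Topology.PlaneTopology Literature.Probability.LatticeModels Literature.Probability.RandomPlanarGeometry

namespace Literature.Probability.Percolation

/-! ### The four arcs of a conformal rectangle: parameters -/

section Params

variable (R : ConformalRectangle)

/-- The marks of a conformal rectangle: `0 ≤ m₀ < m₁ < m₂ < m₃ < m₀ + 1`. [folklore] -/
theorem cr_marks : 0 ≤ R.mark 0 ∧ R.mark 0 < R.mark 1 ∧ R.mark 1 < R.mark 2 ∧ R.mark 2 < R.mark 3 ∧ R.mark 3 < R.mark 0 + 1 := by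
  refine ⟨(R.mark_mem 0).1, R.strictMono_mark (by decide), R.strictMono_mark (by decide), R.strictMono_mark (by decide), ?_⟩
  have := (R.mark_mem 3).2; have := (R.mark_mem 0).1; linarith

/-- The next marks of a conformal rectangle. [folklore] -/
theorem cr_nextMark : R.nextMark 0 = R.mark 1 ∧ R.nextMark 1 = R.mark 2 ∧ R.nextMark 2 = R.mark 3 ∧ R.nextMark 3 = R.mark 0 + 1 := by
  refine ⟨?_, ?_, ?_, ?_⟩
  · rw [R.nextMark_of_lt 0 (by decide)]; rfl
  · rw [R.nextMark_of_lt 1 (by decide)]; rfl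
  · rw [R.nextMark_of_lt 2 (by decide)]; rfl
  · rw [R.nextMark_of_not_lt 3 (by decide)]

/-- The parameter length of the arc `Aᵢ`. [folklore] -/
def arcLen (i : Fin 4) : ℝ := R.nextMark i - R.mark i

/-- Arc lengths are positive. [folklore] -/
theorem arcLen_pos (i : Fin 4) : 0 < (arcLen R) i := sub_pos.2 (R.mark_lt_nextMark i)

/-- **The end of the previous arc is the start of `Aᵢ`, up to the period**: `nextMark (i + 3) =
mark i + k` with `k = 1` for `i = 0` and `k = 0` otherwise. [folklore] -/
theorem nextMark_add_three (i : Fin 4) : R.nextMark (i + 3) = R.mark i + (if i = 0 then 1 else 0 : ℤ) := by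
  obtain ⟨h0, h1, h2, h3⟩ := (cr_nextMark R)
  fin_cases i
  · simp only [Fin.zero_eta, zero_add, Fin.isValue, ↓reduceIte, Int.cast_one]; exact h3
  · simp only [Fin.mk_one, Fin.isValue, one_ne_zero, ↓reduceIte, Int.cast_zero, add_zero]
    exact h0
  · simp only [Fin.reduceFinMk, Fin.isValue, Fin.reduceAdd, Fin.reduceEq, ↓reduceIte, Int.cast_zero, add_zero]
    exact h1
  · simp only [Fin.reduceFinMk, Fin.isValue, Fin.reduceAdd, Fin.reduceEq, ↓reduceIte, Int.cast_zero, add_zero]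
    exact h2

/-- **Two consecutive arcs do not exhaust the boundary**: `len (i + 3) + len i < 1`. [folklore] -/
theorem len_add_three_add_len_lt_one (i : Fin 4) : (arcLen R) (i + 3) + (arcLen R) i < 1 := by
  obtain ⟨hm0, h01, h12, h23, h30⟩ := (cr_marks R)
  obtain ⟨n0, n1, n2, n3⟩ := (cr_nextMark R)
  fin_cases i <;> simp only [arcLen, Fin.zero_eta, Fin.mk_one, Fin.reduceFinMk, Fin.isValue, Fin.reduceAdd, zero_add] <;>
    first
    | (rw [n3, n0]; linarith)
    | (rw [n0, n1]; linarith)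
    | (rw [n1, n2]; linarith)
    | (rw [n2, n3]; linarith)

/-- **A point of the previous arc has a parameter just below `mark i`**: within `len (i + 3)` below.
[folklore] -/
theorem exists_param_of_mem_arc_add_three (i : Fin 4) {q : ℂ} (hq : q ∈ R.arc (i + 3)) :
    ∃ σ : ℝ, R.boundary σ = q ∧ R.mark i - (arcLen R) (i + 3) ≤ σ ∧ σ ≤ R.mark i := by
  obtain ⟨s, hs, rfl⟩ := hq
  set k : ℤ := if i = 0 then 1 else 0 with hk
  have hnm := (nextMark_add_three R) i
  refine ⟨s - k, ?_, ?_, ?_⟩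
  · have := (R.periodic_boundary.int_mul (-k)) s
    rw [mul_one] at this
    rw [sub_eq_add_neg, ← Int.cast_neg, this]
  · rw [arcLen]; linarith [hs.1, hs.2]
  · linarith [hs.2]

/-- **Parameters just below `mark i` are on the previous arc.** [folklore] -/
theorem boundary_mem_arc_add_three (i : Fin 4) {t : ℝ} (h1 : R.mark i - (arcLen R) (i + 3) ≤ t) (h2 : t ≤ R.mark i) :
    R.boundary t ∈ R.arc (i + 3) := by
  set k : ℤ := if i = 0 then 1 else 0 with hk
  have hnm := (nextMark_add_three R) i
  refine ⟨t + k, ⟨?_, ?_⟩, ?_⟩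
  · rw [arcLen] at h1; linarith
  · linarith
  · have := (R.periodic_boundary.int_mul k) t
    rwa [mul_one] at this

/-- Parameters of the interval of `Aᵢ` are on `Aᵢ`. [folklore] -/
theorem boundary_mem_arc_of_mem_Icc (i : Fin 4) {t : ℝ} (h : t ∈ Icc (R.mark i) (R.nextMark i)) : R.boundary t ∈ R.arc i :=
  ⟨t, h, rfl⟩

end Params

/-! ### The label after `i` is `i + 1` -/

section Order

variable (R : ConformalRectangle) {δ : ℝ} (hδ : 0 < δ) {c₀ : Site 2} (hc₀ : c₀ ∈ innerCoarse R.carrier δ)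

/-- **The label following the label `i` is `i + 1`** (see the module docstring for the hypotheses).
[cite: BollobasRiordan2006, Ch. 7 §7.2.5 p. 191] -/
theorem IsLabel.next_eq_add_one (hind : ∀ z ∈ R.carrier, R.index z = 1)
    {ρ η cpt carc : ℝ}
    (hη : ∀ q ∈ frontier R.carrier, ∀ i k : Fin 4, k ≠ i → infDist q (R.arc i) < η → infDist q (R.arc k) < η →
      ∃ m : Fin 4, (m = i ∨ m = i + 1) ∧ R.pt m ∈ R.arc k ∧ dist q (R.pt m) < ρ)
    (hδη : 48 * δ < η)
    (hcpt : ∀ m m' : Fin 4, m ≠ m' → cpt ≤ dist (R.pt m) (R.pt m')) (hρpt : 2 * ρ + 25 * δ < cpt)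
    (hcarc : ∀ (m i : Fin 4), R.pt m ∉ R.arc i → carc ≤ infDist (R.pt m) (R.arc i)) (hρarc : ρ + 25 * δ < carc)
    {i j : Fin 4} {n₁ n₂ c : ℕ} (h12 : n₁ < n₂) (h2c : n₂ < c)
    (hcN : c < n₁ + (triBdryDarts (innerApprox R.toJordanDomain hδ hc₀).verts).card)
    (hn₁ : IsLabel R hδ hc₀ n₁ i) (hcj : IsLabel R hδ hc₀ c j) (hji : j ≠ i)
    (honly : ∀ b, n₁ < b → b < c → ∀ k, IsLabel R hδ hc₀ b k → k = i)
    (d21 : 24 * δ < dist (triMeshPoint δ (ztail R hδ hc₀ n₂)) (triMeshPoint δ (ztail R hδ hc₀ n₁)))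
    (d23 : 24 * δ < dist (triMeshPoint δ (ztail R hδ hc₀ n₂)) (triMeshPoint δ (ztail R hδ hc₀ c)))
    -- the far point: an interior point of the opposite arc with a face of `G` nearby
    {tx r : ℝ} (htx : tx ∈ Ioo (R.mark (i + 2)) (R.nextMark (i + 2))) (hr : 0 < r)
    (hr2 : ∀ k, k ≠ i + 2 → ∀ z ∈ R.arc k, r ≤ dist z (R.boundary tx))
    (hρr : ρ + 25 * δ < r / 2)
    (hxF : ∃ F₀ : HexVertex, hexFaceVertices F₀ ⊆ (innerApprox R.toJordanDomain hδ hc₀).verts ∧ dist (meshCenter δ F₀) (R.boundary tx) < r / 2) :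
    j = i + 1 := by
  set G := innerApprox R.toJordanDomain hδ hc₀ with hG
  set N := (triBdryDarts G.verts).card with hN
  ---------------------------------------------------------------------------------------------
  -- (1) the corner zone between the last label `i` and `c`: `j = i + 1` or `j = i + 3`
  ---------------------------------------------------------------------------------------------
  -- the last position before `c` labelled `i`
  classical
  obtain ⟨l, hl, hli, hlast⟩ : ∃ l, n₁ ≤ l ∧ l < c ∧ IsLabel R hδ hc₀ l i ∧ ∀ b, l < b → b < c → ∀ k, ¬ IsLabel R hδ hc₀ b k := by
    set S := (Finset.range c).filter fun b => n₁ ≤ b ∧ IsLabel R hδ hc₀ b i with hS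
    have hSne : S.Nonempty := ⟨n₁, Finset.mem_filter.2 ⟨Finset.mem_range.2 (h12.trans h2c), le_rfl, hn₁⟩⟩
    obtain ⟨l, hlS, hmax⟩ := S.exists_max_image id hSne
    obtain ⟨hlc, hl1, hli⟩ := Finset.mem_filter.1 hlS
    refine ⟨l, hl1, Finset.mem_range.1 hlc, hli, fun b hlb hbc k hbk => ?_⟩
    have hbi : k = i := honly b (by omega) hbc k hbk
    subst hbi
    have := hmax b (Finset.mem_filter.2 ⟨Finset.mem_range.2 hbc, by omega, hbk⟩)
    simp only [id] at this
    omega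
  obtain ⟨hl1, hlc, hli, hlast⟩ := hl, hli, hlast
  -- positions strictly between `l` and `c` are in corner zones, all the same corner `m`
  have hzone : ∀ b, l < b → b < c → ∃ m, IsCornerZone R hδ hc₀ ρ b m := fun b hlb hbc => by
    rcases exists_zone (R := R) (hδ := hδ) (hc₀ := hc₀) hη hδη b with ⟨k, hk⟩ | h
    · exact absurd hk (hlast b hlb hbc k)
    · exact h
  -- `l + 1 < c`: two consecutive positions with different labels are impossible
  have hl2 : l + 1 < c := by
    rcases Nat.lt_or_ge (l + 1) c with h | h
    · exact h
    · exfalso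
      have hlc' : l + 1 = c := by omega
      exact hji (hli.eq_of_succ (hlc' ▸ hcj)).symm
  obtain ⟨m, hm⟩ := hzone (l + 1) (by omega) hl2
  have hm_all : ∀ b, l < b → b < c → IsCornerZone R hδ hc₀ ρ b m := by
    intro b hlb hbc
    induction b with
    | zero => omega
    | succ b ih =>
      rcases Nat.lt_or_ge l b with hlb' | hlb'
      · have hb := ih hlb' (by omega)
        obtain ⟨m', hm'⟩ := hzone (b + 1) hlb hbc
        rwa [IsCornerZone.eq_of_succ hcpt hρpt hb hm'] at *
      · have : b = l := by omega
        subst this; exact hm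
  have hm_i : m = i ∨ m = i + 1 := hli.corner_succ hcarc hρarc hm
  have hm_j : m = j ∨ m = j + 1 := by
    have hc1 : IsCornerZone R hδ hc₀ ρ (c - 1) m := hm_all (c - 1) (by omega) (by omega)
    have := hc1.label_succ hcarc hρarc (i := j) (by rwa [show c - 1 + 1 = c by omega])
    exact this
  have hj : j = i + 1 ∨ j = i + 3 := by
    rcases hm_i with hmi | hmi <;> rcases hm_j with hmj | hmj
    · exact absurd (hmj.symm.trans hmi) hji
    · right
      rw [show i = j + 1 from hmi.symm.trans hmj]
      fin_cases j <;> decide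
    · left; exact hmj.symm.trans hmi
    · exact absurd (add_right_cancel (hmj.symm.trans hmi)) hji
  ---------------------------------------------------------------------------------------------
  -- (2) `j = i + 3` contradicts `tips_advance`
  ---------------------------------------------------------------------------------------------
  rcases hj with hj | hj
  · exact hj
  exfalso
  subst hj
  -- parameters: `σ₁ ∈ [mark i, nextMark i]` for the tip at `n₁`, `σ₃ ∈ [mark i - len (i+3), mark i]` for the tip at `c`
  obtain ⟨σ₁, hσ₁, hq₁⟩ := hn₁.1
  obtain ⟨σ₃, hq₃, hσ₃1, hσ₃2⟩ := (exists_param_of_mem_arc_add_three R) i hcj.1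
  have hlen := (len_add_three_add_len_lt_one R) i
  have h13 : |σ₁ - σ₃| < 1 := by
    rw [abs_lt]; simp only [arcLen] at hlen hσ₃1; constructor <;> linarith [hσ₁.1, hσ₁.2, (arcLen_pos R) (i + 3)]
  -- the direct arc lies in `A_{i+3} ∪ A_i`
  have hdirect : ∀ z ∈ R.boundary '' Icc (min σ₁ σ₃) (max σ₁ σ₃), z ∈ R.arc (i + 3) ∨ z ∈ R.arc i := by
    rintro z ⟨t, ht, rfl⟩
    rw [min_eq_right (hσ₃2.trans hσ₁.1), max_eq_left (hσ₃2.trans hσ₁.1)] at ht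
    rcases le_total t (R.mark i) with h | h
    · exact Or.inl ((boundary_mem_arc_add_three R) i (hσ₃1.trans ht.1) h)
    · exact Or.inr ((boundary_mem_arc_of_mem_Icc R) i ⟨h, ht.2.trans hσ₁.2⟩)
  -- every tip between `n₁` and `c` is at distance `≥ r - ρ` from the far point `x`
  set x := R.boundary tx with hx
  have hxfr : x ∈ frontier R.carrier := R.boundary_mem_frontier tx
  have hi2 : i + 3 ≠ i + 2 := by fin_cases i <;> decide
  have hi2' : i ≠ i + 2 := by fin_cases i <;> decide
  have hcorner_far : ∀ m' : Fin 4, r ≤ dist (R.pt m') x := by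
    intro m'
    -- `P_{m'}` lies on an arc other than `A_{i+2}`: on `A_{m'}` and on `A_{m'+3}`; one of them is not `i + 2`
    by_cases hm' : m' = i + 2
    · have hmem : R.pt m' ∈ R.arc (m' + 3) := R.pt_mem_arc_iff.2 (Or.inr (by rw [add_assoc, show (3 : Fin 4) + 1 = 0 by decide, add_zero]))
      exact hr2 (m' + 3) (by rw [hm']; fin_cases i <;> decide) _ hmem
    · exact hr2 m' hm' _ (R.pt_mem_arc_self m')
  have hρ0 : 0 < ρ := lt_of_le_of_lt dist_nonneg hm.2
  have htip_far : ∀ b, n₁ ≤ b → b ≤ c → r - ρ ≤ dist (ztip R hδ hc₀ b) x := by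
    intro b h1b hbc
    rcases eq_or_lt_of_le hbc with rfl | hbc'
    · have := hr2 (i + 3) hi2 _ hcj.1; linarith [hρr, hδ.le]
    rcases exists_zone (R := R) (hδ := hδ) (hc₀ := hc₀) hη hδη b with ⟨k, hk⟩ | ⟨m', hm'⟩
    · have hki : k = i := by
        rcases eq_or_lt_of_le h1b with rfl | h1b'
        · exact hk.eq hn₁
        · exact honly b h1b' hbc' k hk
      subst hki
      have := hr2 k hi2' _ hk.1; linarith [hρr, hδ.le]
    · have h1 := hcorner_far m'
      have h2 := hm'.2
      have := dist_triangle (R.pt m') (ztip R hδ hc₀ b) x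
      rw [dist_comm] at h2
      linarith
  -- hence the ball `B(x, r/2)` misses the direct arc, the two tethers and the tail polyline
  have hxα : ∀ z ∈ ball x (r / 2), z ∉ R.boundary '' Icc (min σ₁ σ₃) (max σ₁ σ₃) := by
    intro z hz hzmem
    rcases hdirect z hzmem with h | h
    · have := hr2 (i + 3) hi2 z h; rw [mem_ball] at hz; linarith
    · have := hr2 i hi2' z h; rw [mem_ball] at hz; linarith
  have htail_far : ∀ b, n₁ ≤ b → b ≤ c → r - ρ - 12 * δ ≤ dist (triMeshPoint δ (ztail R hδ hc₀ b)) x := by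
    intro b h1b hbc
    have h1 := htip_far b h1b hbc
    have h2 := dist_ztip_ztail_le (R := R) (hδ := hδ) (hc₀ := hc₀) b
    have := dist_triangle (ztip R hδ hc₀ b) (triMeshPoint δ (ztail R hδ hc₀ b)) x
    linarith
  have hx1 : ∀ z ∈ ball x (r / 2), 12 * δ < dist z (triMeshPoint δ (ztail R hδ hc₀ n₁)) := by
    intro z hz
    have h1 := htail_far n₁ le_rfl (by omega)
    have := dist_triangle (triMeshPoint δ (ztail R hδ hc₀ n₁)) z x
    rw [mem_ball] at hz; rw [dist_comm z]; linarith
  have hx3 : ∀ z ∈ ball x (r / 2), 12 * δ < dist z (triMeshPoint δ (ztail R hδ hc₀ (n₁ + (c - n₁)))) := by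
    intro z hz
    rw [show n₁ + (c - n₁) = c by omega]
    have h1 := htail_far c (by omega) le_rfl
    have := dist_triangle (triMeshPoint δ (ztail R hδ hc₀ c)) z x
    rw [mem_ball] at hz; rw [dist_comm z]; linarith
  have hxκ : ∀ z ∈ ball x (r / 2), ∀ k < c - n₁, z ∉ segment ℝ (triMeshPoint δ (ztail R hδ hc₀ (n₁ + k)))
      (triMeshPoint δ (ztail R hδ hc₀ (n₁ + k + 1))) := by
    intro z hz k hk hzseg
    have h1 := htail_far (n₁ + k) (by omega) (by omega)
    have h2 := htail_far (n₁ + k + 1) (by omega) (by omega)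
    -- the segment is within `r - ρ - 12δ` … of `x`? No: its points are within `δ` of the tail `n₁ + k`
    have hd : dist z (triMeshPoint δ (ztail R hδ hc₀ (n₁ + k))) ≤ δ :=
      dist_le_of_mem_segment (by rw [dist_self]; exact hδ.le)
        (by rw [dist_comm]; exact dist_ztail_succ_le (R := R) (hδ := hδ) (hc₀ := hc₀) (n₁ + k)) hzseg
    have := dist_triangle (triMeshPoint δ (ztail R hδ hc₀ (n₁ + k))) z x
    rw [mem_ball] at hz; rw [dist_comm] at hd
    linarith
  -- `tips_advance`
  have hadv := tips_advance G.isTriDisc (innerCompFinset_conn R.toJordanDomain hδ) R.toJordanDomain hind hδ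
    (innerApprox_deep R.toJordanDomain hδ hc₀) (pTether R hδ hc₀)
    (σ₁ := σ₁) (σ₃ := σ₃) (n₁ := n₁) (k₂ := n₂ - n₁) (k₃ := c - n₁) (by omega) (by show c - n₁ < N; omega)
    (by rw [hq₁]; rfl) (by rw [show n₁ + (c - n₁) = c by omega, hq₃]; rfl) h13
    (by rw [show n₁ + (n₂ - n₁) = n₂ by omega]; exact d21)
    (by rw [show n₁ + (n₂ - n₁) = n₂ by omega, show n₁ + (c - n₁) = c by omega]; exact d23)
    hxfr (half_pos hr) hxF hxα hx1 hx3 hxκ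
  linarith [hσ₃2, hσ₁.1]

end Order

end Literature.Probability.Percolation
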